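import Summits.MatrixMultiplication.MatrixMultiplication.Theorems.ObstructionDescentRankRestrictedWindow

set_option linter.dupNamespace false

/-!
# Obstruction descent, part AD — SIGN PROPAGATION ALONG THE FORMAT TOWER

`route-MatrixMultiplication-ObstructionDescent`, aside `InvariantSaturation` (stmt 32282); decomp-mm lens-3, NODE-g16.

Part AC's low-rank transfer step iterates: a slot character of the level space at ONE format `N₀` determines the slot
symmetry of the level-`k` highest weight vectors of EVERY format `N ≥ N₀` on low rank.

* §1 `lowRankChar_corner` (a low-rank character passes to corner embeddings), `lowRankChar_succ` (one step up the tower),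
  **`lowRankChar_iterate`** (any rank schedule `ρ` with `(k−1)ρ_{n+1} < k(N₀+n+1)` and `ρ_{n+1} ≤ ρ_n + 1`),
  `lowRankChar_iterate_of_slotChar` (start from a polynomial identity `g^σ = χ·g` on `R_k(N₀)`).
* §2 LEVEL `3` — **SIGN PROPAGATION LAW `evalT_permT_level_three_propagate`**: if `σ` acts by the scalar `χ` on `R₃(N₀)`
  and `2c ≤ 3N₀`, then for every `n`, every `f ∈ R₃(N₀ + n)` and every tensor `t` of rank `≤ n + c`:
  `f(σ·t) = χ·f(t)`.  From `N₀ = 4`, `c = 6` (`evalT_permT_level_three_of_four`, `evalT_permT_level_three`): **every level-3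
  highest weight vector of every format `N ≥ 4` satisfies `f(σ·t) = χ·f(t)` for all `t` of rank `≤ N + 2`**, where `χ`
  is the scalar by which `σ` acts on the line `R₃(4) = ℂ·G₄` (census I42/I45: `−1` for the transpositions).  From
  `N₀ = 3` (Strassen's `R₃(3) = ℂ·F₃`), `c = 4`: rank `≤ N + 1`.
* §3 consequences, all formats `N ≥ 4` at once, from the ONE datum at format `4`: `χ ≠ 1` ⇒ every `f ∈ R₃(N)` vanishes at
  every `σ`-symmetric tensor of rank `≤ N + 2` (`evalT_eq_zero_level_three_of_permT_eq_self`), in particular at the unit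
  tensors: `f(⟨N⟩) = 0`, and `3 ∉ pointLevels N ⟨m⟩` for `N ≤ m ≤ N + 2` (`evalT_unitTensor_eq_zero_level_three`,
  `three_not_mem_pointLevels_unitTensor`); a level-3 vector with its own `σ`-character `χ_f ≠ χ` dies on `σ_{N+2}`
  (`evalT_eq_zero_level_three_of_slotChar_ne`: for `χ = −1`, the `σ`-EVEN part of `R₃(N)` lies in `I(σ_{N+2})` — this is
  how `H₅ ∈ I(σ₇)` and `G₆ ∈ I(σ₈)` (signs `+`) follow from the sign `−` of `G₄`); and with part AB, if `R₃(4)` is a line: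
  every `f ∈ R₃(N)`, `N ≥ 4`, is CYCLICALLY SLOT-SYMMETRIC on `σ_{N+2}` (`evalT_permT_cycle_level_three`) — the symmetry of
  the matrix multiplication tensors — and all three transpositions act there by the one sign of `G₄`
  (`exists_sign_level_three`).

[cite: BurgisserIkenmeyer2011, §3.1–3.2, §6.2], [cite: BurgisserIkenmeyer2017, §5 (5.2), Thm 5.3], [cite: LandsbergGCT2017, §2.1, §8.3].
-/

noncomputable section

open scoped BigOperators
open Finset

namespace Summit.MatrixMultiplication.MatrixMultiplication.Theorems.ObstructionCalculus

open Literature.Computability.AlgebraicComplexity (tensorRank unitTensor)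

/-! ### §1 Iterating the low-rank transfer step -/

section Iterate

/-- A low-rank character of the full-format level space `R_k(N)` passes to its corner embedding at every ambient format
`m ≥ N` (same rank bound). [this node] -/
theorem lowRankChar_corner {N m k ρ : ℕ} (hNm : N ≤ m) (σ : Equiv.Perm (Fin 3)) {χ : ℂ}
    (h : ∀ f ∈ hwvSpace (rectType N N k) (k * N), ∀ t : Tensor ℂ N, tensorRank t ≤ ρ →
      evalT (permT σ t) f = χ * evalT t f) :
    ∀ W ∈ hwvSpace (rectType m N k) (k * N), ∀ s : Tensor ℂ m, tensorRank s ≤ ρ →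
      evalT (permT σ s) W = χ * evalT s W := by
  obtain ⟨d, rfl⟩ : ∃ d, m = d + N := ⟨m - N, by omega⟩
  intro W hW s hs
  obtain ⟨w, hw, rfl⟩ := exists_eq_liftPoly_of_mem_hwvSpace le_rfl hW
  rw [evalT_liftPoly, evalT_liftPoly, cornerOf_permT]
  exact h w hw _ ((tensorRank_cornerOf_le d s).trans hs)

/-- **One step up the tower:** a character of `R_k(m')` on rank `≤ ρ` gives the same character of `R_k(m'+1)` on rank
`≤ r`, `(k−1)r < k(m'+1)`, `r ≤ ρ + 1`. [this node] -/
theorem lowRankChar_succ {m' k ρ r : ℕ} (σ : Equiv.Perm (Fin 3)) {χ : ℂ}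
    (h : ∀ f ∈ hwvSpace (rectType m' m' k) (k * m'), ∀ t : Tensor ℂ m', tensorRank t ≤ ρ →
      evalT (permT σ t) f = χ * evalT t f)
    (hr : (k - 1) * r < k * (m' + 1)) (hρ : r ≤ ρ + 1) :
    ∀ f ∈ hwvSpace (rectType (m' + 1) (m' + 1) k) (k * (m' + 1)), ∀ t : Tensor ℂ (m' + 1), tensorRank t ≤ r →
      evalT (permT σ t) f = χ * evalT t f :=
  fun _ hf _ ht => evalT_permT_eq_mul_of_lowRank σ (lowRankChar_corner (Nat.le_succ m') σ h) hf hr hρ ht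

/-- **Iteration along a rank schedule.**  If `σ` acts by `χ` on `R_k(N₀)` on rank `≤ ρ₀` and the schedule `ρ` satisfies
`(k−1)·ρ_{n+1} < k·(N₀+n+1)` and `ρ_{n+1} ≤ ρ_n + 1`, then `σ` acts by `χ` on `R_k(N₀+n)` on rank `≤ ρ_n` for every `n`.
[this node] -/
theorem lowRankChar_iterate {N₀ k : ℕ} (σ : Equiv.Perm (Fin 3)) {χ : ℂ} (ρ : ℕ → ℕ)
    (h0 : ∀ f ∈ hwvSpace (rectType N₀ N₀ k) (k * N₀), ∀ t : Tensor ℂ N₀, tensorRank t ≤ ρ 0 →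
      evalT (permT σ t) f = χ * evalT t f)
    (hsched : ∀ n, (k - 1) * ρ (n + 1) < k * (N₀ + n + 1) ∧ ρ (n + 1) ≤ ρ n + 1) (n : ℕ) :
    ∀ f ∈ hwvSpace (rectType (N₀ + n) (N₀ + n) k) (k * (N₀ + n)), ∀ t : Tensor ℂ (N₀ + n), tensorRank t ≤ ρ n →
      evalT (permT σ t) f = χ * evalT t f := by
  induction n with
  | zero => exact h0
  | succ n ih => exact lowRankChar_succ σ ih (hsched n).1 (hsched n).2

/-- The same, started from a polynomial identity `g^σ = χ·g` on all of `R_k(N₀)` (any `ρ₀`). [this node] -/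
theorem lowRankChar_iterate_of_slotChar {N₀ k : ℕ} (σ : Equiv.Perm (Fin 3)) {χ : ℂ} (ρ : ℕ → ℕ)
    (hV : ∀ g ∈ hwvSpace (rectType N₀ N₀ k) (k * N₀), MvPolynomial.rename (slotPerm σ) g = χ • g)
    (hsched : ∀ n, (k - 1) * ρ (n + 1) < k * (N₀ + n + 1) ∧ ρ (n + 1) ≤ ρ n + 1) (n : ℕ) :
    ∀ f ∈ hwvSpace (rectType (N₀ + n) (N₀ + n) k) (k * (N₀ + n)), ∀ t : Tensor ℂ (N₀ + n), tensorRank t ≤ ρ n →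
      evalT (permT σ t) f = χ * evalT t f :=
  lowRankChar_iterate σ ρ (fun g hg t _ => evalT_permT_of_slotChar σ (hV g hg) t) hsched n

end Iterate

/-! ### §2 Level `3`: the sign propagation law -/

section LevelThree

/-- **SIGN PROPAGATION LAW (level 3).**  If `σ` acts by the scalar `χ` on `R₃(N₀)` and `2c ≤ 3N₀`, then for every `n`, every
`f ∈ R₃(N₀ + n)` and every tensor `t` of rank `≤ n + c`: `f(σ·t) = χ·f(t)`. [this node] -/
theorem evalT_permT_level_three_propagate {N₀ c : ℕ} (hc : 2 * c ≤ 3 * N₀) (σ : Equiv.Perm (Fin 3)) {χ : ℂ}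
    (hV : ∀ g ∈ hwvSpace (rectType N₀ N₀ 3) (3 * N₀), MvPolynomial.rename (slotPerm σ) g = χ • g) (n : ℕ)
    {f : MvPolynomial (Idx (N₀ + n)) ℂ} (hf : f ∈ hwvSpace (rectType (N₀ + n) (N₀ + n) 3) (3 * (N₀ + n)))
    {t : Tensor ℂ (N₀ + n)} (ht : tensorRank t ≤ n + c) : evalT (permT σ t) f = χ * evalT t f :=
  lowRankChar_iterate_of_slotChar σ (fun n => n + c) hV (fun n => ⟨by omega, by omega⟩) n f hf t ht

/-- **From format 4: rank `≤ N + 2` at every format `N = 4 + n`.**  If `σ` acts by `χ` on `R₃(4)` (census: `R₃(4) = ℂ·G₄`,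
sign `−1` under the transpositions), every level-3 highest weight vector `f` of format `4 + n` satisfies `f(σ·t) = χ·f(t)`
for `R(t) ≤ n + 6`. [this node] -/
theorem evalT_permT_level_three_of_four (σ : Equiv.Perm (Fin 3)) {χ : ℂ}
    (hV : ∀ g ∈ hwvSpace (rectType 4 4 3) (3 * 4), MvPolynomial.rename (slotPerm σ) g = χ • g) (n : ℕ)
    {f : MvPolynomial (Idx (4 + n)) ℂ} (hf : f ∈ hwvSpace (rectType (4 + n) (4 + n) 3) (3 * (4 + n)))
    {t : Tensor ℂ (4 + n)} (ht : tensorRank t ≤ n + 6) : evalT (permT σ t) f = χ * evalT t f :=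
  evalT_permT_level_three_propagate (by norm_num) σ hV n hf ht

/-- **Format-`N` form:** `σ` acts by `χ` on `R₃(4)` ⇒ for every `N ≥ 4`, every `f ∈ R₃(N)` and every `t` of rank `≤ N + 2`,
`f(σ·t) = χ·f(t)`. [this node] -/
theorem evalT_permT_level_three (σ : Equiv.Perm (Fin 3)) {χ : ℂ}
    (hV : ∀ g ∈ hwvSpace (rectType 4 4 3) (3 * 4), MvPolynomial.rename (slotPerm σ) g = χ • g) {N : ℕ} (hN : 4 ≤ N)
    {f : MvPolynomial (Idx N) ℂ} (hf : f ∈ hwvSpace (rectType N N 3) (3 * N)) {t : Tensor ℂ N}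
    (ht : tensorRank t ≤ N + 2) : evalT (permT σ t) f = χ * evalT t f := by
  obtain ⟨n, rfl⟩ : ∃ n, N = 4 + n := ⟨N - 4, by omega⟩
  exact evalT_permT_level_three_of_four σ hV n hf (by omega)

/-- Corner form at any ambient format `m ≥ N ≥ 4`: the corner-type level-3 vectors of block format `N` have `σ`-character `χ` on
rank `≤ N + 2`. [this node] -/
theorem evalT_permT_level_three_corner (σ : Equiv.Perm (Fin 3)) {χ : ℂ}
    (hV : ∀ g ∈ hwvSpace (rectType 4 4 3) (3 * 4), MvPolynomial.rename (slotPerm σ) g = χ • g) {N m : ℕ} (hN : 4 ≤ N)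
    (hNm : N ≤ m) {F : MvPolynomial (Idx m) ℂ} (hF : F ∈ hwvSpace (rectType m N 3) (3 * N)) {s : Tensor ℂ m}
    (hs : tensorRank s ≤ N + 2) : evalT (permT σ s) F = χ * evalT s F :=
  lowRankChar_corner hNm σ (fun _ hf _ ht => evalT_permT_level_three σ hV hN hf ht) F hF s hs

/-- **From format 3 (Strassen's line `R₃(3) = ℂ·F₃`): rank `≤ N + 1`.** [this node] -/
theorem evalT_permT_level_three_of_three (σ : Equiv.Perm (Fin 3)) {χ : ℂ}
    (hV : ∀ g ∈ hwvSpace (rectType 3 3 3) (3 * 3), MvPolynomial.rename (slotPerm σ) g = χ • g) {N : ℕ} (hN : 3 ≤ N)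
    {f : MvPolynomial (Idx N) ℂ} (hf : f ∈ hwvSpace (rectType N N 3) (3 * N)) {t : Tensor ℂ N}
    (ht : tensorRank t ≤ N + 1) : evalT (permT σ t) f = χ * evalT t f := by
  obtain ⟨n, rfl⟩ : ∃ n, N = 3 + n := ⟨N - 3, by omega⟩
  exact evalT_permT_level_three_propagate (c := 4) (by norm_num) σ hV n hf (by omega)

end LevelThree

/-! ### §3 Consequences at all formats `N ≥ 4` -/

section Consequences

/-- **Vanishing at symmetric low-rank tensors, all formats.**  If `σ` acts on `R₃(4)` by a scalar `χ ≠ 1`, every level-3 highest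
weight vector of every format `N ≥ 4` vanishes at every `σ`-symmetric tensor of rank `≤ N + 2`. [this node] -/
theorem evalT_eq_zero_level_three_of_permT_eq_self (σ : Equiv.Perm (Fin 3)) {χ : ℂ} (hχ : χ ≠ 1)
    (hV : ∀ g ∈ hwvSpace (rectType 4 4 3) (3 * 4), MvPolynomial.rename (slotPerm σ) g = χ • g) {N : ℕ} (hN : 4 ≤ N)
    {f : MvPolynomial (Idx N) ℂ} (hf : f ∈ hwvSpace (rectType N N 3) (3 * N)) {t : Tensor ℂ N}
    (ht : tensorRank t ≤ N + 2) (hsym : permT σ t = t) : evalT t f = 0 := by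
  have h := evalT_permT_level_three σ hV hN hf ht
  rw [hsym] at h
  have h' : (χ - 1) * evalT t f = 0 := by rw [sub_mul, one_mul, ← h, sub_self]
  exact (mul_eq_zero.mp h').resolve_left (sub_ne_zero.mpr hχ)

/-- **Unit tensors, all formats:** `χ ≠ 1` on `R₃(4)` ⇒ `f(⟨N⟩) = 0` for every `f ∈ R₃(N)`, `N ≥ 4`. [this node] -/
theorem evalT_unitTensor_eq_zero_level_three (σ : Equiv.Perm (Fin 3)) {χ : ℂ} (hχ : χ ≠ 1)
    (hV : ∀ g ∈ hwvSpace (rectType 4 4 3) (3 * 4), MvPolynomial.rename (slotPerm σ) g = χ • g) {N : ℕ} (hN : 4 ≤ N)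
    {f : MvPolynomial (Idx N) ℂ} (hf : f ∈ hwvSpace (rectType N N 3) (3 * N)) : evalT (unitTensor ℂ N) f = 0 :=
  evalT_eq_zero_level_three_of_permT_eq_self σ hχ hV hN hf ((tensorRank_unitTensor_le' N).trans (by omega))
    (permT_unitTensor σ)

/-- Corner form: `χ ≠ 1` on `R₃(4)` ⇒ the corner-type level-3 vectors of block format `N ≥ 4` vanish at every `σ`-symmetric
tensor of rank `≤ N + 2` of the ambient format, in particular at `⟨m⟩` for `N ≤ m ≤ N + 2`. [this node] -/
theorem evalT_unitTensor_eq_zero_level_three_corner (σ : Equiv.Perm (Fin 3)) {χ : ℂ} (hχ : χ ≠ 1)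
    (hV : ∀ g ∈ hwvSpace (rectType 4 4 3) (3 * 4), MvPolynomial.rename (slotPerm σ) g = χ • g) {N m : ℕ} (hN : 4 ≤ N)
    (hNm : N ≤ m) (hm : m ≤ N + 2) {F : MvPolynomial (Idx m) ℂ} (hF : F ∈ hwvSpace (rectType m N 3) (3 * N)) :
    evalT (unitTensor ℂ m) F = 0 := by
  have h := evalT_permT_level_three_corner σ hV hN hNm hF ((tensorRank_unitTensor_le' m).trans hm)
  rw [permT_unitTensor] at h
  have h' : (χ - 1) * evalT (unitTensor ℂ m) F = 0 := by rw [sub_mul, one_mul, ← h, sub_self]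
  exact (mul_eq_zero.mp h').resolve_left (sub_ne_zero.mpr hχ)

/-- **Level 3 is not a level of `⟨m⟩` at block format `N`, `4 ≤ N ≤ m ≤ N + 2`** (given `χ ≠ 1` on `R₃(4)`). [this node] -/
theorem three_not_mem_pointLevels_unitTensor (σ : Equiv.Perm (Fin 3)) {χ : ℂ} (hχ : χ ≠ 1)
    (hV : ∀ g ∈ hwvSpace (rectType 4 4 3) (3 * 4), MvPolynomial.rename (slotPerm σ) g = χ • g) {N m : ℕ} (hN : 4 ≤ N)
    (hNm : N ≤ m) (hm : m ≤ N + 2) : 3 ∉ pointLevels N (unitTensor ℂ m) := by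
  rintro ⟨F, hF, hne⟩
  exact hne (evalT_unitTensor_eq_zero_level_three_corner σ hχ hV hN hNm hm hF)

/-- **Other isotypic components die on `σ_{N+2}`:** if `σ` acts by `χ` on `R₃(4)` and `f ∈ R₃(N)`, `N ≥ 4`, has its own
`σ`-character `χ_f ≠ χ` (`f^σ = χ_f·f`), then `f(t) = 0` for every `t` of rank `≤ N + 2`.  For `χ = −1`: the `σ`-even level-3
vectors of every format lie in `I(σ_{N+2})` (e.g. `H₅ ∈ I(σ₇)`, `G₆ ∈ I(σ₈)` from their signs `+`). [this node] -/
theorem evalT_eq_zero_level_three_of_slotChar_ne (σ : Equiv.Perm (Fin 3)) {χ χf : ℂ} (hne : χf ≠ χ)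
    (hV : ∀ g ∈ hwvSpace (rectType 4 4 3) (3 * 4), MvPolynomial.rename (slotPerm σ) g = χ • g) {N : ℕ} (hN : 4 ≤ N)
    {f : MvPolynomial (Idx N) ℂ} (hf : f ∈ hwvSpace (rectType N N 3) (3 * N))
    (hfχ : MvPolynomial.rename (slotPerm σ) f = χf • f) {t : Tensor ℂ N} (ht : tensorRank t ≤ N + 2) :
    evalT t f = 0 := by
  have h := evalT_permT_level_three σ hV hN hf ht
  rw [evalT_permT_of_slotChar σ hfχ] at h
  have h' : (χf - χ) * evalT t f = 0 := by rw [sub_mul, h, sub_self]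
  exact (mul_eq_zero.mp h').resolve_left (sub_ne_zero.mpr hne)

/-- The same in lower-bound form: a level-3 vector of format `N ≥ 4` with `σ`-character `≠ χ` that does NOT vanish at `t` forces
`R(t) ≥ N + 3`. [this node] -/
theorem le_tensorRank_level_three_of_slotChar_ne (σ : Equiv.Perm (Fin 3)) {χ χf : ℂ} (hne : χf ≠ χ)
    (hV : ∀ g ∈ hwvSpace (rectType 4 4 3) (3 * 4), MvPolynomial.rename (slotPerm σ) g = χ • g) {N : ℕ} (hN : 4 ≤ N)
    {f : MvPolynomial (Idx N) ℂ} (hf : f ∈ hwvSpace (rectType N N 3) (3 * N))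
    (hfχ : MvPolynomial.rename (slotPerm σ) f = χf • f) {t : Tensor ℂ N} (ht : evalT t f ≠ 0) :
    N + 3 ≤ tensorRank t := by
  by_contra hlt
  exact ht (evalT_eq_zero_level_three_of_slotChar_ne σ hne hV hN hf hfχ (by omega))

/-- **Cyclic slot symmetry of all level-3 vectors (from the line `R₃(4) = ℂ·G₄`).**  If `R₃(4)` is a line `ℂ·G`, `G ≠ 0`, then
for every `N ≥ 4`, every `f ∈ R₃(N)` is invariant under cyclic rotation of the three slots on tensors of rank `≤ N + 2` — the
symmetry type of the matrix multiplication tensors. [this node] -/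
theorem evalT_permT_cycle_level_three {G : MvPolynomial (Idx 4) ℂ} (hGm : G ∈ hwvSpace (rectType 4 4 3) (3 * 4))
    (hG0 : G ≠ 0) (hline : ∀ g ∈ hwvSpace (rectType 4 4 3) (3 * 4), ∃ c : ℂ, g = c • G) {N : ℕ} (hN : 4 ≤ N)
    {f : MvPolynomial (Idx N) ℂ} (hf : f ∈ hwvSpace (rectType N N 3) (3 * N)) {t : Tensor ℂ N}
    (ht : tensorRank t ≤ N + 2) :
    evalT (permT (Equiv.swap 0 1 * Equiv.swap 1 2) t) f = evalT t f ∧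
      evalT (permT (Equiv.swap 1 2 * Equiv.swap 0 1) t) f = evalT t f := by
  obtain ⟨ε, -, -, -, -, hc, hc'⟩ := exists_sign_of_level_line hGm hG0 hline
  have hc1 : ∀ g ∈ hwvSpace (rectType 4 4 3) (3 * 4),
      MvPolynomial.rename (slotPerm (Equiv.swap 0 1 * Equiv.swap 1 2)) g = (1 : ℂ) • g :=
    fun g hg => by rw [one_smul]; exact hc g hg
  have hc1' : ∀ g ∈ hwvSpace (rectType 4 4 3) (3 * 4),
      MvPolynomial.rename (slotPerm (Equiv.swap 1 2 * Equiv.swap 0 1)) g = (1 : ℂ) • g :=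
    fun g hg => by rw [one_smul]; exact hc' g hg
  refine ⟨?_, ?_⟩
  · rw [evalT_permT_level_three _ hc1 hN hf ht, one_mul]
  · rw [evalT_permT_level_three _ hc1' hN hf ht, one_mul]

/-- **One sign for all transpositions at all formats:** if `R₃(4)` is a line `ℂ·G`, `G ≠ 0`, there is `ε = ±1` such that for every
`N ≥ 4`, every `f ∈ R₃(N)`, every transposition `τ` and every `t` of rank `≤ N + 2`: `f(τ·t) = ε·f(t)`. [this node] -/
theorem exists_sign_level_three {G : MvPolynomial (Idx 4) ℂ} (hGm : G ∈ hwvSpace (rectType 4 4 3) (3 * 4))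
    (hG0 : G ≠ 0) (hline : ∀ g ∈ hwvSpace (rectType 4 4 3) (3 * 4), ∃ c : ℂ, g = c • G) :
    ∃ ε : ℂ, (ε = 1 ∨ ε = -1) ∧ ∀ (N : ℕ), 4 ≤ N → ∀ f ∈ hwvSpace (rectType N N 3) (3 * N), ∀ t : Tensor ℂ N,
      tensorRank t ≤ N + 2 → ∀ i j : Fin 3, i ≠ j → evalT (permT (Equiv.swap i j) t) f = ε * evalT t f := by
  obtain ⟨ε, hε, h01, h02, h12, -, -⟩ := exists_sign_of_level_line hGm hG0 hline
  refine ⟨ε, hε, fun N hN f hf t ht i j hij => ?_⟩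
  rcases swap_cases i j hij with h | h | h <;> rw [h]
  · exact evalT_permT_level_three _ h01 hN hf ht
  · exact evalT_permT_level_three _ h02 hN hf ht
  · exact evalT_permT_level_three _ h12 hN hf ht

/-- **Odd line at format 4 ⇒ all level-3 vectors of all formats vanish at all transposition-symmetric low-rank tensors:** if
`R₃(4) = ℂ·G`, `G ≠ 0`, with sign `−1` under `(0 1)`, then every `f ∈ R₃(N)`, `N ≥ 4`, vanishes at every tensor of rank
`≤ N + 2` fixed by some transposition of the slots. [this node] -/
theorem evalT_eq_zero_level_three_of_swap_fixed {G : MvPolynomial (Idx 4) ℂ} (hGm : G ∈ hwvSpace (rectType 4 4 3) (3 * 4))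
    (hG0 : G ≠ 0) (hline : ∀ g ∈ hwvSpace (rectType 4 4 3) (3 * 4), ∃ c : ℂ, g = c • G)
    (hodd : MvPolynomial.rename (slotPerm (Equiv.swap 0 1)) G = (-1 : ℂ) • G) {N : ℕ} (hN : 4 ≤ N)
    {f : MvPolynomial (Idx N) ℂ} (hf : f ∈ hwvSpace (rectType N N 3) (3 * N)) {t : Tensor ℂ N}
    (ht : tensorRank t ≤ N + 2) {i j : Fin 3} (hij : i ≠ j) (hsym : permT (Equiv.swap i j) t = t) : evalT t f = 0 := by
  obtain ⟨c, h12⟩ := exists_slotChar_level (Equiv.swap 1 2) hline hGm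
  obtain ⟨h02, h12'⟩ := slotChar_swap_eq hodd h12 hG0
  have hne : (-1 : ℂ) ≠ 1 := by norm_num
  have key : ∀ τ : Equiv.Perm (Fin 3), MvPolynomial.rename (slotPerm τ) G = (-1 : ℂ) • G → permT τ t = t →
      evalT t f = 0 :=
    fun τ hτ hτt => evalT_eq_zero_level_three_of_permT_eq_self τ hne (slotChar_uniform_of_line τ hline hτ) hN hf ht hτt
  rcases swap_cases i j hij with h | h | h
  · exact key _ hodd (h ▸ hsym)
  · exact key _ h02 (h ▸ hsym)
  · exact key _ h12' (h ▸ hsym)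

end Consequences

end Summit.MatrixMultiplication.MatrixMultiplication.Theorems.ObstructionCalculus
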